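import Summits.BirchSwinnertonDyer.Rank1Residual.O6.KatoLocalFloorAnalytic
import HarnessLib

/-!
# BSD rank-≤1 residual cell, class O6 (WILD `p = 3`), Iwasawa side: the LOCAL TOWER LAWS along
# `k_n = ℚ(ζ_{3^{n+1}})⁺` — (F) conductor, (D) minimal discriminant / Kodaira / `d_n`, (C) Tamagawa — the interface
# `LocalTowerDatum` (D-O6-LT), the laws TYPED as EVIDENCE-labelled `@[conjecture]` nodes (THEOREM-candidates (F), (D);
# EVIDENCE (C)) and their PROVED consequences (uniqueness in (D), 2-periodicity of `v_n`, `Kod_n`, integrality of `d_n`);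
# NOTHING ASSERTED. The Ш-growth dictionary that consumes them is the sibling `O6/ShaGrowthDictionary.lean`.

HONEST FRAMING (cell `b2b-bsdres`, run/shared/lean/b2b/bsd-rank1-residual/, verbatim in every file): the goal of
the cell is to DELETE the COMBINATION-SHAPED residual classes of the Birch–Swinnerton-Dyer formula for ALL
analytic-rank `≤ 1` elliptic curves over `ℚ` — assembled STRICTLY from published theorems — so that the rank-`≤ 1`
remainder becomes exactly the CONSTRUCTION-SHAPED classes, which are TYPED (missing-input `Prop`s), NOT attempted.
This is not "finishing BSD". Lane CLASS-CLOSURE (`CLASS-CLOSURE-PLAN.md` §3.4 O6, deliverable (a) STATEMENT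
DISCOVERY with validation and (b) the VERBATIM-EXTENSION sub-partition handed to provers): research routes; no claim
beyond the stated classes; census output is EVIDENCE / conjecture items, never a Literature fact; no main conjecture and
no `p`-adic `L`-function is assumed; nothing is booked; no mark of `RESIDUAL-MAP.md` moves; O6 stays OPEN. Closed
unproved `def : Prop` nodes carry `@[conjecture]` whatever the docstring grade (cc-lead ⟦gen22⟧ (8)(b)). 0 Literature
facts are minted here.

## What is typed (cc-typer-5 GEN 11 = O5/O6 typer of record; ask (ii) of o6-r1 GEN 15, `HOME/INBOX.md`
## 2026-08-22T00:10Z / 00:31Z and `cells/o5o6/TARGETS.md` §O6 (G15-1), (G15-5): "laws (F),(D) as statements over the LPP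
## interface (pure local algebra; a Lean proof needs Tate's algorithm over `k_{n,𝔭}` — file as EVIDENCE decls with the closed
## forms and 1 860/1 860, THEOREM-candidate tag)"; content = o6-r1's memo of record `HOME/b2b-bsdres-o6-r1/gen15/O6-GEN15.md`
## (sha16 in `gen15/SHA16SUMS.gen15`) §0 (i), §1, §5; instrument `gen15/typelaw/typelaw_check.py` (law verifier on the LPP
## tables of kit j140771 / j141522 / j140773 / j141745); placement / names / interface shape / dedup = class typer)

SETTING (memo §1). `W ∈ O6` (`ClassO6 W 3`: additive, potentially good, WILD at `3`, `f := v₃(N) ∈ {3, 4, 5}`),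
`v := v₃(Δ_min/ℚ)`, `k_n := ℚ(ζ_{3^{n+1}})⁺` (`[k_n : ℚ] = 3^n`, `G_n` cyclic of order `3^n`), `𝔭 ∣ 3` the totally
ramified prime of `k_n`, and for `W` base-changed to the completion `k_{n,𝔭}`: `f_n` = conductor exponent, `v_n =
v_𝔭(Δ_min over k_{n,𝔭})`, `Kod_n` = Kodaira symbol, `c_n` = Tamagawa number at `𝔭`, `d_n := (3^n·v − v_n)/12` (the
`ω`-rescaling exponent entering BSD over `k_n`).

* §1 PURE ARITHMETIC: the Ogg table `oggTable` of the seven additive potentially-good Kodaira types with their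
  component numbers `m ∈ {1,2,3,5,7,8,9}` — agreement with the tree's `KodairaSymbol.numComponents` and UNIQUENESS mod
  `12` PROVED (`decide`); the congruence `3^{n+2}·v ≡ 3^n·v (mod 12)` for `n ≥ 1` (PROVED).
* §2 INTERFACE `LocalTowerDatum W` (definition request D-O6-LT; fields NAME data Lean cannot yet define — Mathlib has no
  conductor exponent / Tate's algorithm over the completions `k_{n,𝔭}`: `condExpAt n = f_n`, `valDiscAt n = v_n`,
  `kodairaAt n = Kod_n`, `tamagawaAt n = c_n`), the derived `dAt n = (3^n·v − v_n)/12` (read against the TREE's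
  `v₃(Δ_min)`) and `tamOrdAt n = ord₃ c_n`, the layer-`0` compatibility predicate `ReadsBase` (tree columns `condExp W 3`,
  `v₃(Δ_min)`, `W.kodairaSymbolAt (placeOf 3)`), an interface predicate `realT W T` (a section variable, as for
  `SignedFloorDatum` / `TowerValuation`) and its CONSTRUCTION shape.
* §3 THE LAWS as `@[conjecture]` nodes over `realT` (memo §1 verbatim; census = EVIDENCE): (F) `CondExpTowerLawThree`,
  (D) `DiscriminantTowerLawThree`, (C) `TamagawaTowerLawThree`; PROVED consequences `condExpAt_add_two_eq`,
  `valDiscAt_add_two_eq` (`v_{n+2} = v_n`, `Kod_{n+2} = Kod_n`, `n ≥ 1`, from (F) + (D) + uniqueness: "`Kod_n` alternates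
  by (D) since `3^{n+2} ≡ 3^n·9 (mod 12)`", memo §1 (C)), `LocalTowerDatum.exists_dAt_eq_int` (`d_n ∈ ℤ`).

NOT typed here: the Kodaira flip under base change beyond `oggTable` membership; the mechanism of (C) (Q-O6-G15-C); the
type baselines `E_n(τ)` of memo §2.1 (EVIDENCE); the dictionary / law (G) (sibling file); T-O6-G15 and the local crux (L)
(`O6/KuriharaPollackWildThree.lean`). DEDUP (`lean search` / tree grep on every new top-level name: `LocalTowerDatum`,
`oggTable`, `CondExpTowerLawThree`, `DiscriminantTowerLawThree`, `TamagawaTowerLawThree`, …): no match. Reused by name, not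
re-declared: `phiThree`, `cellLevel`, `SignedFloorDatum` (`O6/KatoLocalFloor*.lean`), `ClassO6`, `condExp` (`Additive/`),
Literature's `KodairaSymbol` / `numComponents`.

References: A. P. Ogg, Amer. J. Math. 89 (1967), Thm. 2 (`v(Δ) = f + m − 1`) [OggAJM1967]; T. Saito, Duke Math. J. 57 (1988)
Thm. 1 (Ogg's formula in general) [Saito1988]; J. Silverman, ATAEC IV §9 Table 4.1, Thm. IV.11.1 [SilvermanATAEC1994];
R. Pollack, J. Number Theory 110 (2005) §2, §5 (the tower template) [Pollack2005]; census: o6-r1 GEN 13–15 LPP tables.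
-/

set_option autoImplicit false

noncomputable section

open scoped Classical

open WeierstrassCurve Literature.NumberTheory.EllipticCurves
  Literature.NumberTheory.EllipticCurves.Rank1Residual
  Literature.NumberTheory.EllipticCurves.Rank1Residual.Typed
  Summit.BirchSwinnertonDyer.Rank1Residual.Additive

open Literature.NumberTheory.DiophantineGeometry (KodairaSymbol)

namespace Summit.BirchSwinnertonDyer.Rank1Residual.O6

/-! ## §1 Pure arithmetic: the Ogg table and the congruence `3^{n+2}v ≡ 3^n v (mod 12)` -/

/-- **The Ogg table**: the seven additive POTENTIALLY GOOD Kodaira types `II, III, IV, I₀*, IV*, III*, II*` with their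
numbers of components `m = 1, 2, 3, 5, 7, 8, 9` (Ogg's formula `v(Δ_min) = f + m − 1`; Silverman ATAEC IV Table 4.1). The
candidate set of law (D). [cite: OggAJM1967, Thm. 2 (v(Δ) = f + m − 1)] [cite: SilvermanATAEC1994, §IV.9 Table 4.1] -/
def oggTable : List (ℕ × KodairaSymbol) :=
  [(1, .II), (2, .III), (3, .IV), (5, .Istar 0), (7, .IVstar), (8, .IIIstar), (9, .IIstar)]

/-- The table's `m` IS the tree's `KodairaSymbol.numComponents` (one vocabulary). [cite: SilvermanATAEC1994, §IV.9 Table 4.1] -/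
theorem oggTable_numComponents : ∀ mk ∈ oggTable, mk.2.numComponents = mk.1 := by
  decide

/-- **Uniqueness in law (D)** (memo §1 (D): "uniqueness because the seven candidates are distinct mod 12"): two entries of
the Ogg table with `m ≡ m′ (mod 12)` coincide — PROVED (`decide`). [folklore] -/
theorem oggTable_unique : ∀ mk ∈ oggTable, ∀ mk' ∈ oggTable, mk.1 % 12 = mk'.1 % 12 → mk = mk' := by
  decide

/-- `3^{n+2}·v ≡ 3^n·v (mod 12)` for `n ≥ 1` (`27 ≡ 3 (mod 12)`): the residue `3^n v mod 12` that selects `v_n` in law (D)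
has period `2` in `n` — the source of every `(−1)^n` term of the Ш-growth law (memo §2.3: "law (D): `3^n v mod 12` has
period 2"). [folklore] -/
theorem pow_mul_modEq_twelve_of_one_le (v n : ℕ) (hn : 1 ≤ n) : 3 ^ (n + 2) * v ≡ 3 ^ n * v [MOD 12] := by
  obtain ⟨m, rfl⟩ : ∃ m, n = m + 1 := ⟨n - 1, by omega⟩
  have h27 : (27 : ℕ) ≡ 3 [MOD 12] := by decide
  have h := h27.mul_right (3 ^ m * v)
  have e1 : 3 ^ (m + 1 + 2) * v = 27 * (3 ^ m * v) := by ring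
  have e2 : 3 ^ (m + 1) * v = 3 * (3 ^ m * v) := by ring
  rw [e1, e2]
  exact h

/-! ## §2 Interface: the local tower datum of a curve (definition request D-O6-LT) -/

/-- **D-O6-LT (interface): the LOCAL TOWER DATUM of `W` at `3`.** For `n ≥ 0` and `W` base-changed to the completion
`k_{n,𝔭}` of `k_n = ℚ(ζ_{3^{n+1}})⁺` at its prime over `3` (`k_{0,𝔭} = ℚ₃`): `condExpAt n = f_n` (conductor exponent),
`valDiscAt n = v_n = v_𝔭(Δ_min(W/k_{n,𝔭}))`, `kodairaAt n = Kod_n`, `tamagawaAt n = c_n = [W(k_{n,𝔭}) : W₀(k_{n,𝔭})]`. The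
structure only NAMES the datum (the instrument of record is PARI `elllocalred` over the layer fields — o6-r1's LPP tables,
kit j140771 / j141522 / j140773 / j141745); that it exists and is unique on O6 is the separate construction shape
`LocalTowerDatum.RealisedShape`; its layer `0` is pinned to the tree's columns by `ReadsBase`. Mathlib has Tate's
algorithm / conductor exponents over neither `ℚ₃` nor the `k_{n,𝔭}` as functions, hence an interface (as
`TowerValuation`, `SignedFloorDatum`). [cite: SilvermanATAEC1994, §IV.9 (Tate's algorithm) and §IV.10–11 (conductor)] -/
structure LocalTowerDatum (W : WeierstrassCurve ℚ) where
  /-- `f_n`, the conductor exponent of `W` over `k_{n,𝔭}`. -/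
  condExpAt : ℕ → ℕ
  /-- `v_n = v_𝔭(Δ_min)` of `W` over `k_{n,𝔭}` (normalised valuation of `k_{n,𝔭}`). -/
  valDiscAt : ℕ → ℕ
  /-- `Kod_n`, the Kodaira symbol of `W` over `k_{n,𝔭}`. -/
  kodairaAt : ℕ → KodairaSymbol
  /-- `c_n`, the Tamagawa number of `W` at the prime `𝔭 ∣ 3` of `k_n`. -/
  tamagawaAt : ℕ → ℕ

namespace LocalTowerDatum

variable {W : WeierstrassCurve ℚ}

/-- **`d_n := (3^n·v₃(Δ_min/ℚ) − v_n)/12`** — the `ω`-rescaling exponent of BSD over `k_n` (memo §1 notation; an integer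
under law (D): `LocalTowerDatum.exists_dAt_eq_int`). Read against the TREE's `v₃(Δ_min)`. [folklore] -/
def dAt [W.IsElliptic] [W.IsGloballyMinimal] (T : LocalTowerDatum W) (n : ℕ) : ℚ :=
  ((3 : ℚ) ^ n * (padicValInt 3 W.minimalDiscriminantInt : ℚ) - (T.valDiscAt n : ℚ)) / 12

/-- `ord₃ c_n`. [folklore] -/
def tamOrdAt (T : LocalTowerDatum W) (n : ℕ) : ℕ := padicValNat 3 (T.tamagawaAt n)

/-- **Layer-0 compatibility with the tree's columns**: `f_0 = condExp W 3`, `v_0 = v₃(Δ_min)`, `Kod_0 = W.kodairaSymbolAt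
(placeOf 3)`. (The Tamagawa column `c_0 = c₃(W)` is Literature's `(W.baseChange ℚ_[3]).localTamagawaNumber ℤ_[3]`; it is
not imported here and not needed by any statement below.) A predicate `realT W T` is expected to entail. [folklore] -/
def ReadsBase [W.IsElliptic] [W.IsGloballyMinimal] (T : LocalTowerDatum W) : Prop :=
  T.condExpAt 0 = condExp W 3 ∧ T.valDiscAt 0 = padicValInt 3 W.minimalDiscriminantInt ∧
    T.kodairaAt 0 = W.kodairaSymbolAt (placeOf 3)

/-- Under `ReadsBase`, `d_0 = 0`. [folklore] -/
theorem dAt_zero_of_readsBase [W.IsElliptic] [W.IsGloballyMinimal] (T : LocalTowerDatum W) (h : T.ReadsBase) :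
    T.dAt 0 = 0 := by
  simp [dAt, h.2.1]

end LocalTowerDatum

/-- **CONSTRUCTION shape for D-O6-LT** (hypothesis schema over the interface predicate `realT`, not a conjecture node):
on O6 the local tower datum exists, is unique, and reads the tree's layer-`0` columns. Nothing asserted.
**BINDING of `realT`** (referee A R157 §C.5 reading flag `o6-towerlaw-realT-parameter`; the same sentence governs `real` of
`SignedFloorDatum`, `realM`, `realL`, `realN` of the sibling interfaces): every node of §3 (and of the files importing this one)
takes `realT` as an EXPLICIT parameter because D-O6-LT is not constructed; the INTENDED binding is the predicate "`T` is THE local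
tower datum of `W`: `f_n, v_n, Kod_n, c_n` = conductor exponent, minimal-discriminant valuation, Kodaira symbol and Tamagawa number
of `W` over the completion `k_{n,𝔭}` of the `n`-th cyclotomic layer, as computed by Tate's algorithm" (instrument of record: PARI
`elllocalred` over `k_{n,𝔭}`, o6-r1's LPP tables). A consumer states `(hT : LocalTowerDatum.RealisedShape realT) →
CondExpTowerLawThree realT → …` and keeps `realT` abstract until D-O6-LT lands, at which point `realT := fun W T => T = localTowerDatum W`
discharges it; `realT := fun _ _ => True` (over-strong: the laws for arbitrary data) and `realT := fun _ _ => False` (vacuous) are NOT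
legitimate bindings and no record may cite a node so instantiated. [folklore] -/
def LocalTowerDatum.RealisedShape
    (realT : ∀ (W : WeierstrassCurve ℚ) [W.IsElliptic] [W.IsGloballyMinimal], LocalTowerDatum W → Prop) : Prop :=
  ∀ (W : WeierstrassCurve ℚ) [W.IsElliptic] [W.IsGloballyMinimal],
    ClassO6 W 3 → (∃! T : LocalTowerDatum W, realT W T) ∧ ∀ T : LocalTowerDatum W, realT W T → T.ReadsBase

/-! ## §3 The local tower laws (F), (D), (C) of o6-r1 GEN 15 (`@[conjecture]` nodes over `realT`; EVIDENCE-labelled) -/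

section Laws

variable (realT : ∀ (W : WeierstrassCurve ℚ) [W.IsElliptic] [W.IsGloballyMinimal], LocalTowerDatum W → Prop)

/-- **(F) CONDUCTOR TOWER LAW `CondExpTowerLawThree` (THEOREM-CANDIDATE, o6-r1 GEN 15 memo §1 (F); `@[conjecture]` until a
kernel proof; EVIDENCE-labelled; the derivation is "routine local theory (to be written)": the wild inertia group of `W`
at `3` has order `3` (`f = 4`, cyclic image) or sits in a group of order `12` (`f ∈ {3, 5}`); over the totally ramified
`3`-extension `k_{n,𝔭}` the Swan conductor is multiplied by the ramification-compatible factor and the tame part is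
unchanged — Serre–Tate conductor formula).** For `W ∈ O6` and all `n ≥ 1`: `f = 3 ⇒ f_n = 3`; `f = 5 ⇒ f_n = 7`;
`f = 4 ⇒ f_n = f_1 ∈ {0, 2, 4}`, the branch being read at `n = 1` (`f_1 = 4`: wild inertia survives over `k_{1,𝔭}`;
`f_1 ∈ {0, 2}`: `k_{1,𝔭}` kills the wild part). Why it might fail: a curve of O6 whose conductor exponent over some layer
differs from the table (one LPP row with the instrument OK refutes it).
[evidence: census cell O6, o6-r1 GEN 13–15: `gen15/typelaw/typelaw_check.py` on the LPP tables gen14/lpp/j140771, gen14/kf5/j141522, gen13/lpp/j140773 (island n ≤ 4(5), KF4, KF5): f_n law exact on 1 860 / 1 860 rows, 0 violations]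
[cite: SilvermanATAEC1994, §IV.10 (conductor; Ogg–Saito formula IV.11.1)] -/
@[conjecture] def CondExpTowerLawThree : Prop :=
  ∀ (W : WeierstrassCurve ℚ) [W.IsElliptic] [W.IsGloballyMinimal] (T : LocalTowerDatum W),
    ClassO6 W 3 → realT W T →
      (condExp W 3 = 3 → ∀ n, 1 ≤ n → T.condExpAt n = 3) ∧
      (condExp W 3 = 5 → ∀ n, 1 ≤ n → T.condExpAt n = 7) ∧
      (condExp W 3 = 4 →
        (T.condExpAt 1 = 0 ∨ T.condExpAt 1 = 2 ∨ T.condExpAt 1 = 4) ∧ ∀ n, 1 ≤ n → T.condExpAt n = T.condExpAt 1)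

/-- **(D) DISCRIMINANT / KODAIRA TOWER LAW `DiscriminantTowerLawThree` (THEOREM-CANDIDATE, o6-r1 GEN 15 memo §1 (D);
`@[conjecture]` until a kernel proof; EVIDENCE-labelled; reason in print: Ogg's formula `v_n = f_n + m_n − 1` and the
invariance of `v(Δ) mod 12` under change of model; uniqueness = `oggTable_unique`).** For `W ∈ O6` and all `n ≥ 1`:
`v_n ≡ 3^n·v₃(Δ_min) (mod 12)` (so `d_n = (3^n v − v_n)/12 ∈ ℤ`); if `f_n = 0` then `v_n = 0` and `Kod_n = I₀` (good
reduction over `k_{n,𝔭}`); if `f_n ≠ 0` then `(m_n, Kod_n)` is an entry of the Ogg table (`Kod_n ∈ {II, III, IV, I₀*, IV*,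
III*, II*}`, `m_n` its number of components) with `v_n = f_n + m_n − 1` — by `oggTable_unique` the UNIQUE entry with
`f_n + m − 1 ≡ 3^n v (mod 12)`. The Kodaira symbol over the layer is thus DETERMINED by `(f_n, 3^n v mod 12)`; no flip
rule beyond table membership is asserted. Why it might fail: a layer of an O6 curve with potentially multiplicative or
`f_n = 1` behaviour (impossible for potentially good reduction), or a `v_n` off the congruence (one LPP row refutes it).
[evidence: census cell O6, o6-r1 GEN 13–15 (`typelaw_check.py`, same 1 860 LPP rows): Kod_n, d_n, v_n all exact, 0 violations; the gen-14 ε-clause it replaces was wrong at (4,IV)/(4,IV*) n = 5 (d₅ = 202, confirmed by kit j141745: 405d1, 405e1, 567b1, 648c1)]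
[cite: OggAJM1967, Thm. 2] [cite: Saito1988, Theorem 1] [cite: SilvermanATAEC1994, §IV.9 Table 4.1 and IV.11.1] -/
@[conjecture] def DiscriminantTowerLawThree : Prop :=
  ∀ (W : WeierstrassCurve ℚ) [W.IsElliptic] [W.IsGloballyMinimal] (T : LocalTowerDatum W),
    ClassO6 W 3 → realT W T → ∀ n, 1 ≤ n →
      T.valDiscAt n ≡ 3 ^ n * padicValInt 3 W.minimalDiscriminantInt [MOD 12] ∧
      (T.condExpAt n = 0 → T.valDiscAt n = 0 ∧ T.kodairaAt n = .I 0) ∧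
      (T.condExpAt n ≠ 0 →
        ∃ mk ∈ oggTable, T.kodairaAt n = mk.2 ∧ T.valDiscAt n + 1 = T.condExpAt n + mk.1)

/-- **(C) TAMAGAWA TOWER PERIODICITY `TamagawaTowerLawThree` (CONJECTURE; KILLABLE; EVIDENCE-labelled; o6-r1 GEN 15 memo
§1 (C): "EVIDENCE only — mechanism: `Kod_n` alternates by (D) since `3^{n+2} ≡ 3^n·9 (mod 12)`, and `c` is determined by
`Kod_n` and a quadratic condition whose tower behaviour is 2-periodic; Q-O6-G15-C: derive from Tate's algorithm").** For
`W ∈ O6` and all `n ≥ 1`: `c_{n+2} = c_n` — the Tamagawa number at `𝔭` alternates with period `2` or is constant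
(`405d1: 1,1,1,1,1`; `405e1: 3,1,3,1,3`; `567b1: 1,3,1,3,1`). Why it might fail: a non-split/split condition at `𝔭` that is
not 2-periodic up the tower; one LPP pair `(n, n+2)` with `c_{n+2} ≠ c_n` refutes it.
[evidence: census cell O6, o6-r1 GEN 14/15: c_{n+2} = c_n on 690 / 690 measured (curve, n) pairs of the LPP tables + the four kit-j141745 curves at n = 5]
[cite: SilvermanATAEC1994, §IV.9 Table 4.1 (c_v by type and splitting)] -/
@[conjecture] def TamagawaTowerLawThree : Prop :=
  ∀ (W : WeierstrassCurve ℚ) [W.IsElliptic] [W.IsGloballyMinimal] (T : LocalTowerDatum W),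
    ClassO6 W 3 → realT W T → ∀ n, 1 ≤ n → T.tamagawaAt (n + 2) = T.tamagawaAt n

end Laws

/-! ### PROVED consequences of (F) + (D): 2-periodicity of `v_n`, `Kod_n`; integrality of `d_n` -/

/-- Under the (F)-clause for `W`, the layer conductor exponent is CONSTANT in `n ≥ 1` (all three branches), given
`f ∈ {3, 4, 5}` (the defining range `v₃(N) ∈ {3,4,5}` of O6, an explicit hypothesis as in `newPoleOrder_starred`).
[folklore] -/
theorem condExpAt_add_two_eq (W : WeierstrassCurve ℚ) [W.IsElliptic] [W.IsGloballyMinimal] (T : LocalTowerDatum W)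
    (hf : condExp W 3 = 3 ∨ condExp W 3 = 4 ∨ condExp W 3 = 5)
    (hF : (condExp W 3 = 3 → ∀ n, 1 ≤ n → T.condExpAt n = 3) ∧
      (condExp W 3 = 5 → ∀ n, 1 ≤ n → T.condExpAt n = 7) ∧
      (condExp W 3 = 4 →
        (T.condExpAt 1 = 0 ∨ T.condExpAt 1 = 2 ∨ T.condExpAt 1 = 4) ∧ ∀ n, 1 ≤ n → T.condExpAt n = T.condExpAt 1))
    (n : ℕ) (hn : 1 ≤ n) : T.condExpAt (n + 2) = T.condExpAt n := by
  rcases hf with h | h | h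
  · rw [hF.1 h n hn, hF.1 h (n + 2) (by omega)]
  · rw [(hF.2.2 h).2 n hn, (hF.2.2 h).2 (n + 2) (by omega)]
  · rw [hF.2.1 h n hn, hF.2.1 h (n + 2) (by omega)]

/-- **2-PERIODICITY from (F) + (D)** (memo §1 (C) mechanism / §2.3: "`Kod_n` alternates by (D)"): if the layer conductor is
constant and the (D)-clauses hold at `n` and `n + 2` (`n ≥ 1`), then `v_{n+2} = v_n` and `Kod_{n+2} = Kod_n` — because
`3^{n+2}v ≡ 3^n v (mod 12)` and the Ogg table entry is unique mod `12`. [folklore] -/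
theorem valDiscAt_add_two_eq (W : WeierstrassCurve ℚ) [W.IsElliptic] [W.IsGloballyMinimal] (T : LocalTowerDatum W)
    (n : ℕ) (hn : 1 ≤ n) (hfn : T.condExpAt (n + 2) = T.condExpAt n)
    (hDn : T.valDiscAt n ≡ 3 ^ n * padicValInt 3 W.minimalDiscriminantInt [MOD 12] ∧
      (T.condExpAt n = 0 → T.valDiscAt n = 0 ∧ T.kodairaAt n = .I 0) ∧
      (T.condExpAt n ≠ 0 → ∃ mk ∈ oggTable, T.kodairaAt n = mk.2 ∧ T.valDiscAt n + 1 = T.condExpAt n + mk.1))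
    (hDn2 : T.valDiscAt (n + 2) ≡ 3 ^ (n + 2) * padicValInt 3 W.minimalDiscriminantInt [MOD 12] ∧
      (T.condExpAt (n + 2) = 0 → T.valDiscAt (n + 2) = 0 ∧ T.kodairaAt (n + 2) = .I 0) ∧
      (T.condExpAt (n + 2) ≠ 0 →
        ∃ mk ∈ oggTable, T.kodairaAt (n + 2) = mk.2 ∧ T.valDiscAt (n + 2) + 1 = T.condExpAt (n + 2) + mk.1)) :
    T.valDiscAt (n + 2) = T.valDiscAt n ∧ T.kodairaAt (n + 2) = T.kodairaAt n := by
  by_cases h0 : T.condExpAt n = 0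
  · have h0' : T.condExpAt (n + 2) = 0 := by rw [hfn, h0]
    obtain ⟨hv, hK⟩ := hDn.2.1 h0
    obtain ⟨hv', hK'⟩ := hDn2.2.1 h0'
    exact ⟨by rw [hv, hv'], by rw [hK, hK']⟩
  · have h0' : T.condExpAt (n + 2) ≠ 0 := by rw [hfn]; exact h0
    obtain ⟨mk, hmk, hK, hv⟩ := hDn.2.2 h0
    obtain ⟨mk', hmk', hK', hv'⟩ := hDn2.2.2 h0'
    -- the two residues agree mod 12
    have hper := pow_mul_modEq_twelve_of_one_le (padicValInt 3 W.minimalDiscriminantInt) n hn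
    have hvv : T.valDiscAt (n + 2) ≡ T.valDiscAt n [MOD 12] := (hDn2.1.trans hper).trans hDn.1.symm
    have hvv1 : T.valDiscAt (n + 2) + 1 ≡ T.valDiscAt n + 1 [MOD 12] := hvv.add_right 1
    rw [hv, hv', hfn] at hvv1
    have hmm : mk'.1 ≡ mk.1 [MOD 12] := Nat.ModEq.add_left_cancel' _ hvv1
    have heq : mk' = mk := oggTable_unique mk' hmk' mk hmk hmm
    subst heq
    refine ⟨?_, by rw [hK, hK']⟩
    have : T.valDiscAt (n + 2) + 1 = T.valDiscAt n + 1 := by rw [hv', hv, hfn]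
    omega

/-- Under the (D)-congruence, `12 ∣ 3^n v − v_n` in `ℤ`, i.e. `d_n` is an INTEGER. [folklore] -/
theorem LocalTowerDatum.exists_dAt_eq_int {W : WeierstrassCurve ℚ} [W.IsElliptic] [W.IsGloballyMinimal]
    (T : LocalTowerDatum W) (n : ℕ)
    (h : T.valDiscAt n ≡ 3 ^ n * padicValInt 3 W.minimalDiscriminantInt [MOD 12]) :
    ∃ d : ℤ, T.dAt n = d := by
  obtain ⟨d, hd⟩ : (12 : ℤ) ∣ (3 ^ n * padicValInt 3 W.minimalDiscriminantInt : ℕ) - (T.valDiscAt n : ℕ) :=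
    (Nat.modEq_iff_dvd.mp h)
  refine ⟨d, ?_⟩
  unfold LocalTowerDatum.dAt
  have hd' : ((3 : ℚ) ^ n * (padicValInt 3 W.minimalDiscriminantInt : ℚ) - (T.valDiscAt n : ℚ)) = 12 * (d : ℚ) := by
    have := congrArg (fun z : ℤ => (z : ℚ)) hd
    push_cast at this
    linarith
  rw [hd']
  ring

end Summit.BirchSwinnertonDyer.Rank1Residual.O6

end
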